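import Mathlib.Analysis.Normed.Group.Bounded
import Mathlib.Analysis.Calculus.Deriv.Shift
import Mathlib.Analysis.Calculus.Deriv.Support
import Literature.Analysis.FluidPDE.NewtonKernel
import Literature.Analysis.FluidPDE.PassiveScalarProofs
import HarnessLib

/-!
# Scale-`r` space–time cutoffs on `ℝ × T^d` with the `r⁻¹` derivative bound

Analysis/FluidPDE support file (serves the discharge of the De Rosa–Drivas–Inversi barrier
`Literature.Barriers.AnomalousDissipation.DeRosaDrivasInversi2024_thm12_bounded`, whose proof
tests the local energy balance against cutoffs of space–time cylinders; De Rosa–Drivas–Inversi,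
J. Math. Fluid Mech. 26 (2024), arXiv:2301.09603, proof of Prop. 3.2: "`χ_δ ∈ C^∞_c(B_{2δ}(x);
[0,1])` with `χ_δ ≡ 1` on `B_δ(x)` and `η_δ ∈ C^∞_c((t-(2δ)^α, t+(2δ)^α); [0,1])` such that
`η_δ ≡ 1` on `(t-δ^α, t+δ^α)` … `|∇χ_δ| ≲ δ⁻¹` and `|η'_δ| ≲ δ^{-α}`", here `α = 1`).

Everything is built from the tree's radial cutoff `radialCutoff r₀ r₁` (`FluidPDE/NewtonKernel`:
smooth on inner product spaces, `= 1` on `‖z‖ ≤ r₀`, `= 0` on `‖z‖ ≥ r₁`, values in `[0,1]`)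
at the scale-invariant ratio `r₁ = 2r₀`:

* `exists_norm_fderiv_radialCutoff_two_mul_le`: on a finite-dimensional inner product space
  there is `B ≥ 0` with `‖D(radialCutoff R (2R))(z)‖ ≤ B / R` for all `R > 0`, `z` (chain rule
  from the unit scale `radialCutoff_scale`; generalises the `ℝ³` lemma
  `exists_norm_fderiv_radialCutoff_le` of `SingularKernelTruncation`);
* the **time cutoff** `t ↦ radialCutoff r (2r) (t - t₀)` on `ℝ`: `= 1` on `|t - t₀| ≤ r`, `= 0`
  on `|t - t₀| ≥ 2r`, support in `[t₀ - 2r, t₀ + 2r]`, `|d/dt| ≤ B/r`, derivative `0` off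
  `|t - t₀| ≤ 2r`;
* the **space cutoff** `Torus.transplant (radialCutoff R (2R))` on `T^d` (`TorusMollifier`;
  needs `R ≤ 1/8` so that the profile sits in `B(0, 1/4)`): smooth, `= 1` on
  `card d · ‖z‖ ≤ R`, `= 0` with vanishing gradient on `‖z‖ > 2R` (torus sup norm),
  `‖∇‖ ≤ B/R`; the comparison `‖reprc z‖ ≤ card d · ‖z‖` between the Euclidean norm of the
  centred representative and the quotient sup norm (`norm_reprc_le_card_mul_norm`);
* the **product** `ψ(t, y) = radialCutoff r (2r) (t - t₀) · Θ(x₀ - y)` is a space–time test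
  function supported in `(0, T)` (`Torus.IsSpaceTimeTestIoo`) as soon as `2r < t₀` and
  `t₀ + 2r < T` (`isSpaceTimeTestIoo_radialCutoff_mul_comp_sub`, from the accepted product
  lemmas of `PassiveScalarProofs`).

No new definitions (theorem-only support file).

## References

* L. De Rosa, T. D. Drivas, M. Inversi, *On the support of anomalous dissipation measures*,
  J. Math. Fluid Mech. 26 (2024), arXiv:2301.09603, proof of Prop. 3.2.
* L. C. Evans, *Partial Differential Equations*, 2nd ed. (2010), App. C.4 (cutoff functions).
-/

noncomputable section

open MeasureTheory Set Filter Metric Function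
open scoped ENNReal NNReal InnerProductSpace ContDiff

namespace Literature.Analysis.FluidPDE

/-! ## The `R⁻¹` derivative bound for `radialCutoff R (2R)` -/

section Scale

/-- **Scale-invariant derivative bound.** On a finite-dimensional real inner product space there
is `B ≥ 0` such that `‖D(radialCutoff R (2R))(z)‖ ≤ B / R` for every `R > 0` and every `z`:
`radialCutoff R (2R) = radialCutoff 1 2 (R⁻¹ ·)` (`radialCutoff_scale`) and `D(radialCutoff 1 2)`
is continuous with compact support, hence bounded (Evans, App. C.4; De Rosa–Drivas–Inversi
2024, proof of Prop. 3.2, "`|∇χ_δ| ≲ δ⁻¹`"). [folklore] -/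
theorem exists_norm_fderiv_radialCutoff_two_mul_le (E : Type*) [NormedAddCommGroup E]
    [InnerProductSpace ℝ E] [FiniteDimensional ℝ E] :
    ∃ B : ℝ, 0 ≤ B ∧ ∀ R : ℝ, 0 < R → ∀ z : E,
      ‖fderiv ℝ (radialCutoff R (2 * R) : E → ℝ) z‖ ≤ B / R := by
  have hsm : ContDiff ℝ 1 (radialCutoff 1 2 : E → ℝ) := radialCutoff_contDiff 1 2
  have hc : Continuous (fderiv ℝ (radialCutoff 1 2 : E → ℝ)) := hsm.continuous_fderiv one_ne_zero
  have hsupp : HasCompactSupport (fderiv ℝ (radialCutoff 1 2 : E → ℝ)) :=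
    (hasCompactSupport_radialCutoff (E := E) zero_le_one one_lt_two).fderiv (𝕜 := ℝ)
  obtain ⟨B, hB⟩ := hc.bounded_above_of_compact_support hsupp
  refine ⟨max B 0, le_max_right _ _, fun R hR z => ?_⟩
  have hfun : (radialCutoff R (2 * R) : E → ℝ) = fun w => radialCutoff 1 2 (R⁻¹ • w) := by
    funext w
    have h := radialCutoff_scale (E := E) (r₀ := 1) (r₁ := 2) hR w
    rwa [mul_one, mul_comm] at h
  rw [hfun, fderiv_comp_smul R⁻¹, norm_smul, norm_inv, Real.norm_eq_abs, abs_of_pos hR,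
    div_eq_inv_mul]
  gcongr
  exact (hB _).trans (le_max_left _ _)

/-- The support of `radialCutoff R (2R)` lies in the open ball of radius `2R` (`R > 0`). [folklore] -/
theorem support_radialCutoff_two_mul_subset {E : Type*} [NormedAddCommGroup E] {R : ℝ}
    (hR : 0 < R) : support (radialCutoff R (2 * R) : E → ℝ) ⊆ ball 0 (2 * R) := by
  intro z hz
  rw [mem_ball_zero_iff]
  by_contra h
  exact hz (radialCutoff_eq_zero hR.le (by linarith) (not_lt.1 h))

/-- The topological support of `radialCutoff R (2R)` lies in the closed ball of radius `2R`. [folklore] -/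
theorem tsupport_radialCutoff_two_mul_subset {E : Type*} [NormedAddCommGroup E] {R : ℝ}
    (hR : 0 < R) : tsupport (radialCutoff R (2 * R) : E → ℝ) ⊆ closedBall 0 (2 * R) :=
  tsupport_radialCutoff_subset hR.le (by linarith)

end Scale

/-! ## The time cutoff `t ↦ radialCutoff r (2r) (t - t₀)` on `ℝ` -/

section Time

variable {r t₀ : ℝ}

/-- The time cutoff is smooth. [folklore] -/
theorem contDiff_radialCutoff_sub (r t₀ : ℝ) :
    ContDiff ℝ ∞ (fun t : ℝ => radialCutoff r (2 * r) (t - t₀)) :=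
  (radialCutoff_contDiff (E' := ℝ) r (2 * r)).comp (contDiff_id.sub contDiff_const)

/-- The time cutoff is continuous. [folklore] -/
theorem continuous_radialCutoff_sub (r t₀ : ℝ) :
    Continuous (fun t : ℝ => radialCutoff r (2 * r) (t - t₀)) :=
  (contDiff_radialCutoff_sub r t₀).continuous

/-- The time cutoff equals `1` on `|t - t₀| ≤ r`. [folklore] -/
theorem radialCutoff_sub_eq_one (hr : 0 < r) {t : ℝ} (ht : |t - t₀| ≤ r) :
    radialCutoff r (2 * r) (t - t₀) = 1 :=
  radialCutoff_eq_one hr.le (by linarith) (by rwa [Real.norm_eq_abs])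

/-- The time cutoff vanishes on `2r ≤ |t - t₀|`. [folklore] -/
theorem radialCutoff_sub_eq_zero (hr : 0 < r) {t : ℝ} (ht : 2 * r ≤ |t - t₀|) :
    radialCutoff r (2 * r) (t - t₀) = 0 :=
  radialCutoff_eq_zero hr.le (by linarith) (by rwa [Real.norm_eq_abs])

/-- The time cutoff takes values in `[0, 1]`. [folklore] -/
theorem radialCutoff_sub_mem_Icc (r t₀ t : ℝ) :
    radialCutoff r (2 * r) (t - t₀) ∈ Icc (0 : ℝ) 1 :=
  ⟨radialCutoff_nonneg _ _ _, radialCutoff_le_one _ _ _⟩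

/-- The support of the time cutoff lies in `[t₀ - 2r, t₀ + 2r]`. [folklore] -/
theorem support_radialCutoff_sub_subset (hr : 0 < r) :
    support (fun t : ℝ => radialCutoff r (2 * r) (t - t₀)) ⊆ Icc (t₀ - 2 * r) (t₀ + 2 * r) := by
  intro t ht
  by_contra h
  refine ht (radialCutoff_sub_eq_zero hr ?_)
  rw [mem_Icc, not_and_or, not_le, not_le] at h
  rcases h with h | h
  · rw [abs_of_neg (by linarith)]; linarith
  · rw [abs_of_pos (by linarith)]; linarith

/-- The topological support of the time cutoff lies in `[t₀ - 2r, t₀ + 2r]`. [folklore] -/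
theorem tsupport_radialCutoff_sub_subset (hr : 0 < r) :
    tsupport (fun t : ℝ => radialCutoff r (2 * r) (t - t₀)) ⊆ Icc (t₀ - 2 * r) (t₀ + 2 * r) :=
  closure_minimal (support_radialCutoff_sub_subset hr) isClosed_Icc

/-- The time cutoff has compact support. [folklore] -/
theorem hasCompactSupport_radialCutoff_sub (hr : 0 < r) :
    HasCompactSupport (fun t : ℝ => radialCutoff r (2 * r) (t - t₀)) :=
  HasCompactSupport.of_support_subset_isCompact isCompact_Icc (support_radialCutoff_sub_subset hr)

/-- The derivative of the time cutoff vanishes off `|t - t₀| ≤ 2r`. [folklore] -/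
theorem deriv_radialCutoff_sub_eq_zero (hr : 0 < r) {t : ℝ} (ht : 2 * r < |t - t₀|) :
    deriv (fun t : ℝ => radialCutoff r (2 * r) (t - t₀)) t = 0 := by
  refine deriv_of_notMem_tsupport fun h => ?_
  have h' := tsupport_radialCutoff_sub_subset (t₀ := t₀) hr h
  rw [mem_Icc] at h'
  have : |t - t₀| ≤ 2 * r := abs_le.2 ⟨by linarith, by linarith⟩
  linarith

/-- The `r⁻¹` bound for the derivative of the time cutoff, given the unit-free bound `B` of
`exists_norm_fderiv_radialCutoff_two_mul_le ℝ`. [folklore] -/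
theorem abs_deriv_radialCutoff_sub_le {B : ℝ}
    (hB : ∀ z : ℝ, ‖fderiv ℝ (radialCutoff r (2 * r) : ℝ → ℝ) z‖ ≤ B / r) (t : ℝ) :
    |deriv (fun t : ℝ => radialCutoff r (2 * r) (t - t₀)) t| ≤ B / r := by
  rw [deriv_comp_sub_const, ← Real.norm_eq_abs, norm_deriv_eq_norm_fderiv]
  exact hB _

end Time

/-! ## The space cutoff `transplant (radialCutoff R (2R))` on `T^d` -/

section Space

variable {d : Type*} [Fintype d] {R : ℝ}

/-- **Euclidean norm of the centred representative against the torus norm**: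
`‖reprc z‖ ≤ card d · ‖z‖`. Each coordinate of `reprc z ∈ [-1/2, 1/2)^d` is the representative
of `z i ∈ ℝ/ℤ` of least modulus, so `|reprc z i| = ‖z i‖ ≤ ‖z‖` (`AddCircle.norm_coe_eq_abs_iff`,
the sup norm of `T^d = (ℝ/ℤ)^d`), and `‖v‖₂ ≤ √(card d) maxᵢ |vᵢ| ≤ card d · maxᵢ |vᵢ|`. [folklore] -/
theorem norm_reprc_le_card_mul_norm (z : UnitAddTorus d) :
    ‖FunctionSpaces.Torus.reprc z‖ ≤ Fintype.card d * ‖z‖ := by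
  have hcoord : ∀ i, ‖FunctionSpaces.Torus.reprc z i‖ ≤ ‖z‖ := by
    intro i
    have h1 : ‖((FunctionSpaces.Torus.reprc z i : ℝ) : UnitAddCircle)‖ =
        |FunctionSpaces.Torus.reprc z i| :=
      (AddCircle.norm_coe_eq_abs_iff (1 : ℝ) one_ne_zero).2
        (by simpa using FunctionSpaces.Torus.abs_reprc_apply_le z i)
    have h2 : z i = ((FunctionSpaces.Torus.reprc z i : ℝ) : UnitAddCircle) := by
      conv_lhs => rw [← FunctionSpaces.Torus.proj_reprc z]
      rfl
    rw [Real.norm_eq_abs, ← h1, ← h2]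
    exact norm_le_pi_norm z i
  have hsum : ∑ i, ‖FunctionSpaces.Torus.reprc z i‖ ^ 2 ≤ (Fintype.card d * ‖z‖) ^ 2 := by
    calc ∑ i, ‖FunctionSpaces.Torus.reprc z i‖ ^ 2 ≤ ∑ _i : d, ‖z‖ ^ 2 :=
          Finset.sum_le_sum fun i _ => pow_le_pow_left₀ (norm_nonneg _) (hcoord i) 2
      _ = Fintype.card d * ‖z‖ ^ 2 := by
          rw [Finset.sum_const, Finset.card_univ, nsmul_eq_mul]
      _ ≤ (Fintype.card d * ‖z‖) ^ 2 := by
          rw [mul_pow]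
          refine mul_le_mul_of_nonneg_right ?_ (sq_nonneg _)
          rcases Nat.eq_zero_or_pos (Fintype.card d) with h | h
          · simp [h]
          · have : (1 : ℝ) ≤ Fintype.card d := by exact_mod_cast h
            nlinarith
  rw [EuclideanSpace.norm_eq]
  calc √(∑ i, ‖FunctionSpaces.Torus.reprc z i‖ ^ 2) ≤ √((Fintype.card d * ‖z‖) ^ 2) :=
        Real.sqrt_le_sqrt hsum
    _ = Fintype.card d * ‖z‖ := Real.sqrt_sq (by positivity)

/-- For `0 < R ≤ 1/8` the profile `radialCutoff R (2R)` on `ℝ^d` is supported in `B(0, 1/4)`,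
the hypothesis of the transplant calculus of `TorusMollifier`. [folklore] -/
theorem support_radialCutoff_two_mul_subset_quarter (hR : 0 < R) (hR' : R ≤ 1 / 8) :
    support (radialCutoff R (2 * R) : EuclideanSpace ℝ d → ℝ) ⊆ ball 0 (1 / 4) :=
  (support_radialCutoff_two_mul_subset hR).trans (ball_subset_ball (by linarith))

/-- The space cutoff `transplant (radialCutoff R (2R))` is smooth on `T^d` (`0 < R ≤ 1/8`). [folklore] -/
theorem isSmooth_transplant_radialCutoff (hR : 0 < R) (hR' : R ≤ 1 / 8) :
    FunctionSpaces.Torus.IsSmooth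
      (FunctionSpaces.Torus.transplant (radialCutoff R (2 * R) : EuclideanSpace ℝ d → ℝ)) :=
  FunctionSpaces.Torus.isSmooth_transplant (radialCutoff_contDiff R (2 * R))
    (support_radialCutoff_two_mul_subset_quarter hR hR')

/-- The space cutoff takes values in `[0, 1]`. [folklore] -/
theorem transplant_radialCutoff_mem_Icc (R : ℝ) (z : UnitAddTorus d) :
    FunctionSpaces.Torus.transplant (radialCutoff R (2 * R) : EuclideanSpace ℝ d → ℝ) z ∈
      Icc (0 : ℝ) 1 :=
  ⟨radialCutoff_nonneg _ _ _, radialCutoff_le_one _ _ _⟩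

/-- The space cutoff equals `1` on the torus ball `card d · ‖z‖ ≤ R`
(`norm_reprc_le_card_mul_norm`). [folklore] -/
theorem transplant_radialCutoff_eq_one (hR : 0 < R) {z : UnitAddTorus d}
    (hz : Fintype.card d * ‖z‖ ≤ R) :
    FunctionSpaces.Torus.transplant (radialCutoff R (2 * R) : EuclideanSpace ℝ d → ℝ) z = 1 :=
  radialCutoff_eq_one hR.le (by linarith) ((norm_reprc_le_card_mul_norm z).trans hz)

/-- Off the torus ball of radius `2R` the centred representative is off the topological support
of the profile (`‖z‖ ≤ ‖reprc z‖`, `Torus.norm_le_norm_reprc`). [folklore] -/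
theorem reprc_notMem_tsupport_radialCutoff (hR : 0 < R) {z : UnitAddTorus d} (hz : 2 * R < ‖z‖) :
    FunctionSpaces.Torus.reprc z ∉
      tsupport (radialCutoff R (2 * R) : EuclideanSpace ℝ d → ℝ) := fun h => by
  have h1 := mem_closedBall_zero_iff.1 (tsupport_radialCutoff_two_mul_subset hR h)
  linarith [FunctionSpaces.Torus.norm_le_norm_reprc z]

/-- The space cutoff vanishes off the torus ball of radius `2R`. [folklore] -/
theorem transplant_radialCutoff_eq_zero (hR : 0 < R) {z : UnitAddTorus d} (hz : 2 * R < ‖z‖) :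
    FunctionSpaces.Torus.transplant (radialCutoff R (2 * R) : EuclideanSpace ℝ d → ℝ) z = 0 := by
  rw [FunctionSpaces.Torus.transplant_apply]
  exact image_eq_zero_of_notMem_tsupport (reprc_notMem_tsupport_radialCutoff hR hz)

/-- The gradient of the space cutoff vanishes off the torus ball of radius `2R`
(`Torus.gradient_transplant`, `0 < R ≤ 1/8`). [folklore] -/
theorem gradient_transplant_radialCutoff_eq_zero (hR : 0 < R) (hR' : R ≤ 1 / 8)
    {z : UnitAddTorus d} (hz : 2 * R < ‖z‖) :
    FunctionSpaces.Torus.gradient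
      (FunctionSpaces.Torus.transplant (radialCutoff R (2 * R) : EuclideanSpace ℝ d → ℝ)) z = 0 := by
  rw [FunctionSpaces.Torus.gradient_transplant (support_radialCutoff_two_mul_subset_quarter hR hR'),
    gradient, fderiv_of_notMem_tsupport ℝ (reprc_notMem_tsupport_radialCutoff hR hz), map_zero]

/-- The `R⁻¹` bound for the gradient of the space cutoff, given the unit-free bound `B` of
`exists_norm_fderiv_radialCutoff_two_mul_le (EuclideanSpace ℝ d)` (`0 < R ≤ 1/8`). [folklore] -/
theorem norm_gradient_transplant_radialCutoff_le (hR : 0 < R) (hR' : R ≤ 1 / 8) {B : ℝ}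
    (hB : ∀ v : EuclideanSpace ℝ d, ‖fderiv ℝ (radialCutoff R (2 * R) : EuclideanSpace ℝ d → ℝ) v‖ ≤ B / R)
    (z : UnitAddTorus d) :
    ‖FunctionSpaces.Torus.gradient
      (FunctionSpaces.Torus.transplant (radialCutoff R (2 * R) : EuclideanSpace ℝ d → ℝ)) z‖ ≤ B / R := by
  rw [FunctionSpaces.Torus.gradient_transplant (support_radialCutoff_two_mul_subset_quarter hR hR'),
    gradient, LinearIsometryEquiv.norm_map]
  exact hB _

end Space

/-! ## The product cutoff is a space–time test function supported in `(0, T)` -/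

section Product

variable {d : Type*} [Fintype d]

/-- **Product cutoffs are test functions supported in `(0, T)`.** For `0 < r`, `2r < t₀`,
`t₀ + 2r < T` and a smooth `Θ : T^d → ℝ`, the field `ψ(t, y) = radialCutoff r (2r) (t - t₀) · Θ(x₀ - y)`
satisfies `Torus.IsSpaceTimeTestIoo T ψ`: it is jointly smooth, vanishes for `t ≥ t₀ + 2r`
(`< T`) and for `t ≤ t₀ - 2r` (`> 0`) (De Rosa–Drivas–Inversi 2024, proof of Prop. 3.2:
"testing (1.4) with `χ_δ η_δ`"). [folklore] -/
theorem isSpaceTimeTestIoo_radialCutoff_mul_comp_sub {T r t₀ : ℝ} (hr : 0 < r) (h0 : 2 * r < t₀)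
    (hT : t₀ + 2 * r < T) {Θ : UnitAddTorus d → ℝ} (hΘ : FunctionSpaces.Torus.IsSmooth Θ)
    (x₀ : UnitAddTorus d) :
    FunctionSpaces.Torus.IsSpaceTimeTestIoo T
      (fun t y => radialCutoff r (2 * r) (t - t₀) * Θ (x₀ - y)) := by
  refine ⟨Torus.isSpaceTimeTest_mul_comp_sub (contDiff_radialCutoff_sub r t₀)
    (hasCompactSupport_radialCutoff_sub hr)
    ((tsupport_radialCutoff_sub_subset hr).trans fun t ht => ?_) hΘ x₀, t₀ - 2 * r, by linarith,
    fun t ht => ?_⟩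
  · rw [mem_Iio]
    exact lt_of_le_of_lt ht.2 hT
  · funext y
    show radialCutoff r (2 * r) (t - t₀) * Θ (x₀ - y) = 0
    have h2 : 2 * r ≤ |t - t₀| := by
      rw [abs_of_nonpos (by linarith)]
      linarith
    rw [radialCutoff_sub_eq_zero hr h2, zero_mul]

omit [Fintype d] in
/-- The product cutoff is jointly continuous on `ℝ × T^d`. [folklore] -/
theorem continuous_radialCutoff_mul_comp_sub (r t₀ : ℝ) {Θ : UnitAddTorus d → ℝ}
    (hΘ : Continuous Θ) (x₀ : UnitAddTorus d) :
    Continuous fun z : ℝ × UnitAddTorus d => radialCutoff r (2 * r) (z.1 - t₀) * Θ (x₀ - z.2) :=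
  ((continuous_radialCutoff_sub r t₀).comp continuous_fst).mul
    (hΘ.comp (continuous_const.sub continuous_snd))

end Product

end Literature.Analysis.FluidPDE
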